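import Summits.QuantumFields.YangMills.Theorems.FluctuationComparisonRegPrIntLS2BetaGapOrbitOfStrata
import Summits.QuantumFields.YangMills.Theorems.FluctuationComparisonRegPrIntLS2BetaFlatTubeAllDepthsVolumeUniform
import HarnessLib

/-!
# (RG-K) THE ℤ₂ SEAM TWIST, XII — GAP♯∘'s BODY ON THE WHOLE CASE-B STRATUM, AT EVERY DEPTH, WITH px12 g22's VOLUME-UNIFORM MODULUS `μ(L, K − J)`, OUTRIGHT;
# hence AT EVERY FIXED DEPTH the registered stiffness organ reduces to its irreducible and case-A strata

Helper for crux `stmt-QuantumFields-20520` (`Theses.UnitScaleTilt.FluctuationComparisonRegPrIntL`), the (T)-chain of LINE `semiclassical_s2beta` (cell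
`ym3-torus`, width seat «width 16» px16 g19).  ✓px12 g22 `…S2BetaFlatTubeAllDepthsVolumeUniform.gapFlat_flat_allDepths_volumeUniform` is the tree's first growth letter
with the modulus chosen BEFORE the family, the coupling and the run: GAP♯∘'s body at the flat datum `(V, U₀) = (1, 1)` at every depth `m = K − J` with `μ(L, m)`
([Balaban1985RegularSpaces] Lemma 1 kinematics, induction down the tower).  Part XI (✓`…S2BetaGapOrbitOfStrata`) keyed part X's POINTWISE case-B transport on the
registry's argmin binder.  ONE application inside px12's prefix gives:

* §1 ★★★★ `gapOrbit_caseB_allDepths_volumeUniform (L b₀ p₀) (hb hp) : ∃ γ₁ > 0, ∀ m, ∃ μ > 0, ∀ F γ ≤ γ₁, ∀ J ≤ K with K − J = m, ∀ ε₀ > 0, ∀ V` with central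
  closed-walk holonomies and `PlaqSmall δ V`, `δ ≤ 2`, `∀ U₀ ∈ argminHist V` (spelled out), `∀ U ∈ fibre V ∩ histGood`: `μ·L^{−2(K−J)}·⨅_{w residual} Σ dist1(U ℓ·((w•U₀) ℓ)⁻¹)²
  ≤ A U − minActionRegPr ε₀ V` — the REGISTERED organ's body on the whole case-B stratum, ZERO letters, any `L`, `μ` depending on `L` and the depth only
  (depth `0` by ✓part XI `gapAt_depthZero`).
* §2 ★★★★ `gapOrbit_unless_irr_or_caseA_allDepths_volumeUniform` — the same at EVERY `2`-small datum unless it is irreducible or gauge-abelian of case A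
  (✓part VIII `irr_or_caseA_or_loopHol_central`).
* §3 ★★★★ `uniformFibreGapOrbitAtDepth_of_strata (m) (hIrr) (hA)` — FOR EVERY FIXED DEPTH `m`: the registered `UniformFibreGapOrbit` text with the guard `K − J = m`
  inserted after `(hJK : J ≤ K)` follows from the same guarded text on the irreducible and on the case-A stratum; the flat supplier of ✓part XI
  `uniformFibreGapOrbit_of_strata_of_flat` is PAID at each depth by px12's theorem (prefix threaded as there; `μ := min μ_irr (min μ_A μ_flat(m))`).

HONEST: quantifier plumbing over landed letters; the constants are px12 g22's (crude, GEOMETRIC in the depth) — the DEPTH-uniform modulus of the registered organ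
([Balaban1984PropagatorsII] (1.33), multi-scale) is NOT produced, so `stub_uniformFibreGapOrbit` (all depths, one `μ(L)`) is NOT closed and part XI's flat hypothesis
stays OPEN beyond each fixed depth; the two strata hypotheses ARE the (142)-with-rate ∕ Prop 7 content on irreducible ∕ case-A data (OPEN); TUBE-REG∘, EXW∘,
DET-REP-B, S2β, crux 20520 OPEN; rung R3 (YM₃ on T³) is NOT d = 4, NOT infinite volume, NOT a mass gap, NOT Clay; the Yang–Mills mass gap is NOT proved.
-/

set_option autoImplicit false

noncomputable section

open Set Function
open scoped Matrix.Norms.L2Operator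
open Literature.MathematicalPhysics.QuantumFieldTheory.Balaban1983to89
open Literature.MathematicalPhysics.QuantumFieldTheory.Balaban1983to89.T4Continuum
open Literature.MathematicalPhysics.QuantumFieldTheory.Balaban1983to89.B10Eq27TorusAxialLog (unitsField toUField)
open Literature.MathematicalPhysics.QuantumFieldTheory.Balaban1983to89.B9AdOrthogonal (σ₃)
open Literature.MathematicalPhysics.QuantumFieldTheory.Balaban1983to89.T3ContinuumYM3Torus
open Literature.MathematicalPhysics.QuantumFieldTheory.Balaban1983to89.T3UnitLawDensityEML (ℰp)
open Literature.MathematicalPhysics.QuantumFieldTheory.Balaban1983to89.T3UnitScaleTilt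
open Literature.MathematicalPhysics.QuantumFieldTheory.Balaban1983to89.T3TiltDescent
open Literature.MathematicalPhysics.QuantumFieldTheory.Balaban1983to89.T3Thresholds (exists_gamma_forall_θBal_le)
open Literature.MathematicalPhysics.QuantumFieldTheory.Balaban1983to89.T3ConstrainedMinimiser (fibre)
open Literature.MathematicalPhysics.QuantumFieldTheory.Balaban1983to89.T3PrintedRegularMinimiser
open Literature.MathematicalPhysics.QuantumFieldTheory.Balaban1983to89.T3PrintedRegularOrbits
open scoped Literature.MathematicalPhysics.QuantumFieldTheory.Balaban1983to89.T3OrbitAverage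
open Summit.QuantumFields.YangMills.Theorems.FluctuationComparisonRegPrIntLS2BetaWindowStrataCaseB (irr_or_caseA_or_loopHol_central)
open Summit.QuantumFields.YangMills.Theorems.FluctuationComparisonRegPrIntLS2BetaGapOrbitOfStrata (gapFlatAt_caseB_of_flat_atArgmin gapAt_depthZero gapBody_mono_mu)
open Summit.QuantumFields.YangMills.Theorems.FluctuationComparisonRegPrIntLS2BetaFlatTubeAllDepthsVolumeUniform (gapFlat_flat_allDepths_volumeUniform)

namespace Summit.QuantumFields.YangMills.Theorems.FluctuationComparisonRegPrIntLS2BetaGapOrbitCaseBVolumeUniform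

/-! ## §1 The case-B stratum at every depth, volume-uniform modulus -/

/-- ★★★★ **GAP♯∘'s BODY ON THE WHOLE CASE-B STRATUM AT EVERY DEPTH, WITH A VOLUME-UNIFORM MODULUS `μ(L, K − J)`, ZERO LETTERS**: for every block size `L` and thresholds
`b₀, p₀ > 0` there is `γ₁ > 0` and, for every depth `m`, `μ > 0` — chosen BEFORE the family, the coupling, the run and the datum — such that for every `F` with `F.L = L`,
`0 < γ ≤ γ₁`, `J ≤ K` with `K − J = m`, `ε₀ > 0`, every datum `V` with central closed-walk holonomies at a base point and `PlaqSmall δ V`, `δ ≤ 2`, every ARGMIN base point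
`U₀` (the registry's `argminHist V`, spelled out) and every good history `U` of the fibre: the registered orbit-growth inequality holds with that `μ`
(✓px12 `gapFlat_flat_allDepths_volumeUniform` at `(1,1)` ∘ ✓part XI `gapFlatAt_caseB_of_flat_atArgmin`, pointwise; depth `0` by ✓`gapAt_depthZero`).
[cite: Balaban1985Variational, (142) p.299, Thm 1 (8)-(10) p.279, Prop. 7 p.299, (4)-(6) p.278; Balaban1984PropagatorsII, (1.33); Balaban1985RegularSpaces, Lemma 1 (1.24)-(1.26) pp.79-80] -/
theorem gapOrbit_caseB_allDepths_volumeUniform (L : ℕ) (b₀ p₀ : ℝ) (hb : 0 < b₀) (hp : 0 < p₀) :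
    ∃ γ₁ : ℝ, 0 < γ₁ ∧ ∀ m : ℕ, ∃ μ : ℝ, 0 < μ ∧ ∀ (F : T3Family) (γ : ℝ), F.L = L → 0 < γ → γ ≤ γ₁ →
      ∀ (J K : ℕ) (hJK : J ≤ K), K - J = m → ∀ (ε₀ : ℝ), 0 < ε₀ →
        ∀ (V : GaugeField (F.P J) 0 (Matrix.specialUnitaryGroup (Fin 2) ℂ)) (x₀ : Site (F.P J) 0),
          (∀ w : List (Letter (F.P J).d), walkEnd x₀ w = x₀ →
            ∀ M : Matrix (Fin 2) (Fin 2) ℂ, Commute ((holAt V (walk x₀ w) : Matrix.specialUnitaryGroup (Fin 2) ℂ) : Matrix (Fin 2) (Fin 2) ℂ) M) →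
          ∀ δ : ℝ, δ ≤ 2 → PlaqSmall δ V →
        ∀ U₀ ∈ {U' : GaugeField (F.P K) 0 (Matrix.specialUnitaryGroup (Fin 2) ℂ) | U' ∈ fibre F ℰp J K hJK V ∧ U' ∈ histGood F ℰp (θBal F.L γ b₀ p₀) K J ∧
            wilsonAction4 U' = minActionRegPr F J K hJK ε₀ V},
        ∀ U ∈ fibre F ℰp J K hJK V, U ∈ histGood F ℰp (θBal F.L γ b₀ p₀) K J →
          μ * ((F.L : ℝ)⁻¹) ^ (2 * (K - J)) *
              (⨅ w : {w : GaugeTransf (F.P K) 0 (Matrix.specialUnitaryGroup (Fin 2) ℂ) | ∀ U : GaugeField (F.P K) 0 (Matrix.specialUnitaryGroup (Fin 2) ℂ),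
                  descendTo F ℰp J K hJK (GaugeField.gaugeAct w U) = descendTo F ℰp J K hJK U}, ∑ ℓ : PBond (F.P K) 0,
                dist1 (U ℓ * ((GaugeField.gaugeAct (w : GaugeTransf (F.P K) 0 (Matrix.specialUnitaryGroup (Fin 2) ℂ)) U₀) ℓ)⁻¹) ^ 2)
            ≤ wilsonAction4 U - minActionRegPr F J K hJK ε₀ V := by
  obtain ⟨γ₁, hγ₁, H⟩ := gapFlat_flat_allDepths_volumeUniform L b₀ p₀ hb hp
  refine ⟨γ₁, hγ₁, fun m => ?_⟩
  obtain ⟨μ, hμ, Hm⟩ := H m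
  refine ⟨μ, hμ, ?_⟩
  intro F γ hFL hγ hγle J K hJK hm ε₀ hε₀ V x₀ hcen δ hδ hV U₀ hU₀ U hU hUg
  rcases Nat.eq_or_lt_of_le hJK with hJKeq | hlt
  · subst hJKeq
    exact gapAt_depthZero F J hJK μ V U₀ hU₀.1 hU₀.2.2 U hU hUg
  · exact gapFlatAt_caseB_of_flat_atArgmin F hlt hε₀ μ (Hm F γ hFL hγ hγle J K hlt.le hm ε₀ hε₀) V x₀ hcen hδ hV U₀ hU₀.1 hU₀.2.2 U hU hUg

/-! ## §2 At every `2`-small window datum, unless irreducible or case A -/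

/-- ★★★★ **GAP♯∘'s BODY WITH THE VOLUME-UNIFORM MODULUS `μ(L, K − J)` AT EVERY `2`-SMALL WINDOW DATUM AND EVERY ARGMIN BASE POINT, UNLESS THE DATUM IS IRREDUCIBLE OR
GAUGE-ABELIAN OF CASE A** (same prefix as §1; the first two disjuncts are ✓`irr_or_caseA_or_loopHol_central`'s, VERBATIM; any `L`).
[cite: Balaban1985Variational, (142) p.299, Prop. 7 p.299, (4)-(6) p.278; Balaban1984PropagatorsII, (1.33)] -/
theorem gapOrbit_unless_irr_or_caseA_allDepths_volumeUniform (L : ℕ) (b₀ p₀ : ℝ) (hb : 0 < b₀) (hp : 0 < p₀) :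
    ∃ γ₁ : ℝ, 0 < γ₁ ∧ ∀ m : ℕ, ∃ μ : ℝ, 0 < μ ∧ ∀ (F : T3Family) (γ : ℝ), F.L = L → 0 < γ → γ ≤ γ₁ →
      ∀ (J K : ℕ) (hJK : J ≤ K), K - J = m → ∀ (ε₀ : ℝ), 0 < ε₀ →
        ∀ (V : GaugeField (F.P J) 0 (Matrix.specialUnitaryGroup (Fin 2) ℂ)) (δ : ℝ), δ ≤ 2 → PlaqSmall δ V →
        (∀ c : Site (F.P J) 0 → Matrix (Fin 2) (Fin 2) ℂ,
          (∀ e : PBond (F.P J) 0, c e.src = ((unitsField (toUField V) e : (Matrix (Fin 2) (Fin 2) ℂ)ˣ) : Matrix (Fin 2) (Fin 2) ℂ) * c e.tgt *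
            (((unitsField (toUField V) e)⁻¹ : (Matrix (Fin 2) (Fin 2) ℂ)ˣ) : Matrix (Fin 2) (Fin 2) ℂ)) →
          ∃ z : ℂ, ∀ y, c y = z • (1 : Matrix (Fin 2) (Fin 2) ℂ)) ∨
        (∃ g : GaugeTransf (F.P J) 0 (Matrix.specialUnitaryGroup (Fin 2) ℂ),
          (∀ e : PBond (F.P J) 0, Commute (((GaugeField.gaugeAct g V) e : Matrix.specialUnitaryGroup (Fin 2) ℂ) : Matrix (Fin 2) (Fin 2) ℂ) σ₃) ∧
          ∀ c : Site (F.P J) 0 → Matrix (Fin 2) (Fin 2) ℂ,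
            (∀ e : PBond (F.P J) 0, c e.src = ((unitsField (toUField (GaugeField.gaugeAct g V)) e : (Matrix (Fin 2) (Fin 2) ℂ)ˣ) : Matrix (Fin 2) (Fin 2) ℂ) * c e.tgt *
            (((unitsField (toUField (GaugeField.gaugeAct g V)) e)⁻¹ : (Matrix (Fin 2) (Fin 2) ℂ)ˣ) : Matrix (Fin 2) (Fin 2) ℂ)) →
            ∃ c₀ : Matrix (Fin 2) (Fin 2) ℂ, (∀ y, c y = c₀) ∧ Commute c₀ σ₃) ∨
        (∀ U₀ ∈ {U' : GaugeField (F.P K) 0 (Matrix.specialUnitaryGroup (Fin 2) ℂ) | U' ∈ fibre F ℰp J K hJK V ∧ U' ∈ histGood F ℰp (θBal F.L γ b₀ p₀) K J ∧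
            wilsonAction4 U' = minActionRegPr F J K hJK ε₀ V},
        ∀ U ∈ fibre F ℰp J K hJK V, U ∈ histGood F ℰp (θBal F.L γ b₀ p₀) K J →
          μ * ((F.L : ℝ)⁻¹) ^ (2 * (K - J)) *
              (⨅ w : {w : GaugeTransf (F.P K) 0 (Matrix.specialUnitaryGroup (Fin 2) ℂ) | ∀ U : GaugeField (F.P K) 0 (Matrix.specialUnitaryGroup (Fin 2) ℂ),
                  descendTo F ℰp J K hJK (GaugeField.gaugeAct w U) = descendTo F ℰp J K hJK U}, ∑ ℓ : PBond (F.P K) 0,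
                dist1 (U ℓ * ((GaugeField.gaugeAct (w : GaugeTransf (F.P K) 0 (Matrix.specialUnitaryGroup (Fin 2) ℂ)) U₀) ℓ)⁻¹) ^ 2)
            ≤ wilsonAction4 U - minActionRegPr F J K hJK ε₀ V) := by
  obtain ⟨γ₁, hγ₁, H⟩ := gapOrbit_caseB_allDepths_volumeUniform L b₀ p₀ hb hp
  refine ⟨γ₁, hγ₁, fun m => ?_⟩
  obtain ⟨μ, hμ, Hm⟩ := H m
  refine ⟨μ, hμ, ?_⟩
  intro F γ hFL hγ hγle J K hJK hm ε₀ hε₀ V δ hδ hV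
  rcases irr_or_caseA_or_loopHol_central V with hirr | hcA | ⟨x₀, hcen⟩
  · exact Or.inl hirr
  · exact Or.inr (Or.inl hcA)
  · exact Or.inr (Or.inr (Hm F γ hFL hγ hγle J K hJK hm ε₀ hε₀ V x₀ hcen δ hδ hV))

/-! ## §3 At every fixed depth the registered organ reduces to its two analytic strata -/

/-- ★★★★ **AT EVERY FIXED DEPTH `m`, `UniformFibreGapOrbit`'s TEXT (v11.4, with the guard `K − J = m` inserted after `(hJK : J ≤ K)`; `argminHist` ∕ `ResidualGauge` unfolded)
⟸ THE SAME GUARDED TEXT ON THE IRREDUCIBLE AND ON THE CASE-A STRATUM** — ✓part XI's reduction with its flat-datum hypothesis DISCHARGED at depth `m` by ✓px12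
`gapFlat_flat_allDepths_volumeUniform`; prefix threaded as in ✓parts IX∕XI (`c₀ := min`, `pS := max`, `ε₁ := min`, `γ₁ := min` incl. lit ✓`exists_gamma_forall_θBal_le` at
`σ := 2` for `(cw·b₀, p₀)`, `μ := min μ_irr (min μ_A μ_flat(m))`, ✓`gapBody_mono_mu`).
[cite: Balaban1985Variational, (142) p.299, Thm 1 (8)-(10) p.279, Prop. 7 p.299, (4)-(6) p.278; Balaban1984PropagatorsII, (1.33); Balaban1985UV3, (7) p.257] -/
theorem uniformFibreGapOrbitAtDepth_of_strata (m : ℕ)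
    (hIrr : ∀ (L : ℕ), ∃ c₀ : ℝ, 0 < c₀ ∧ c₀ ≤ 1 ∧ ∀ (cw : ℝ), 0 < cw → cw ≤ c₀ → ∃ pS : ℝ, ∀ (b₀ p₀ : ℝ), 0 < b₀ → pS ≤ p₀ → 0 < p₀ → ∃ ε₁ : ℝ, 0 < ε₁ ∧ ∀ (ε₀ : ℝ), 0 < ε₀ → ε₀ ≤ ε₁ →
    ∃ γ₁ : ℝ, 0 < γ₁ ∧ ∃ μ : ℝ, 0 < μ ∧ ∀ (F : T3Family) (γ : ℝ), F.L = L → 0 < γ → γ ≤ γ₁ →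
      ∀ (J K : ℕ) (hJK : J ≤ K), K - J = m → ∀ (V : GaugeField (F.P J) 0 (Matrix.specialUnitaryGroup (Fin 2) ℂ)), PlaqSmall (θBal F.L γ (cw * b₀) p₀ J) V →
        (∀ c : Site (F.P J) 0 → Matrix (Fin 2) (Fin 2) ℂ,
          (∀ e : PBond (F.P J) 0, c e.src = ((unitsField (toUField V) e : (Matrix (Fin 2) (Fin 2) ℂ)ˣ) : Matrix (Fin 2) (Fin 2) ℂ) * c e.tgt *
            (((unitsField (toUField V) e)⁻¹ : (Matrix (Fin 2) (Fin 2) ℂ)ˣ) : Matrix (Fin 2) (Fin 2) ℂ)) →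
          ∃ z : ℂ, ∀ y, c y = z • (1 : Matrix (Fin 2) (Fin 2) ℂ)) →
        ∀ U₀ ∈ {U' : GaugeField (F.P K) 0 (Matrix.specialUnitaryGroup (Fin 2) ℂ) | U' ∈ fibre F ℰp J K hJK V ∧ U' ∈ histGood F ℰp (θBal F.L γ b₀ p₀) K J ∧
            wilsonAction4 U' = minActionRegPr F J K hJK ε₀ V},
        ∀ U ∈ fibre F ℰp J K hJK V, U ∈ histGood F ℰp (θBal F.L γ b₀ p₀) K J →
          μ * ((F.L : ℝ)⁻¹) ^ (2 * (K - J)) *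
              (⨅ w : {w : GaugeTransf (F.P K) 0 (Matrix.specialUnitaryGroup (Fin 2) ℂ) | ∀ U : GaugeField (F.P K) 0 (Matrix.specialUnitaryGroup (Fin 2) ℂ),
                  descendTo F ℰp J K hJK (GaugeField.gaugeAct w U) = descendTo F ℰp J K hJK U}, ∑ ℓ : PBond (F.P K) 0,
                dist1 (U ℓ * ((GaugeField.gaugeAct (w : GaugeTransf (F.P K) 0 (Matrix.specialUnitaryGroup (Fin 2) ℂ)) U₀) ℓ)⁻¹) ^ 2)
            ≤ wilsonAction4 U - minActionRegPr F J K hJK ε₀ V)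
    (hA : ∀ (L : ℕ), ∃ c₀ : ℝ, 0 < c₀ ∧ c₀ ≤ 1 ∧ ∀ (cw : ℝ), 0 < cw → cw ≤ c₀ → ∃ pS : ℝ, ∀ (b₀ p₀ : ℝ), 0 < b₀ → pS ≤ p₀ → 0 < p₀ → ∃ ε₁ : ℝ, 0 < ε₁ ∧ ∀ (ε₀ : ℝ), 0 < ε₀ → ε₀ ≤ ε₁ →
    ∃ γ₁ : ℝ, 0 < γ₁ ∧ ∃ μ : ℝ, 0 < μ ∧ ∀ (F : T3Family) (γ : ℝ), F.L = L → 0 < γ → γ ≤ γ₁ →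
      ∀ (J K : ℕ) (hJK : J ≤ K), K - J = m → ∀ (V : GaugeField (F.P J) 0 (Matrix.specialUnitaryGroup (Fin 2) ℂ)), PlaqSmall (θBal F.L γ (cw * b₀) p₀ J) V →
        (∃ g : GaugeTransf (F.P J) 0 (Matrix.specialUnitaryGroup (Fin 2) ℂ),
          (∀ e : PBond (F.P J) 0, Commute (((GaugeField.gaugeAct g V) e : Matrix.specialUnitaryGroup (Fin 2) ℂ) : Matrix (Fin 2) (Fin 2) ℂ) σ₃) ∧
          ∀ c : Site (F.P J) 0 → Matrix (Fin 2) (Fin 2) ℂ,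
            (∀ e : PBond (F.P J) 0, c e.src = ((unitsField (toUField (GaugeField.gaugeAct g V)) e : (Matrix (Fin 2) (Fin 2) ℂ)ˣ) : Matrix (Fin 2) (Fin 2) ℂ) * c e.tgt *
            (((unitsField (toUField (GaugeField.gaugeAct g V)) e)⁻¹ : (Matrix (Fin 2) (Fin 2) ℂ)ˣ) : Matrix (Fin 2) (Fin 2) ℂ)) →
            ∃ c₀ : Matrix (Fin 2) (Fin 2) ℂ, (∀ y, c y = c₀) ∧ Commute c₀ σ₃) →
        ∀ U₀ ∈ {U' : GaugeField (F.P K) 0 (Matrix.specialUnitaryGroup (Fin 2) ℂ) | U' ∈ fibre F ℰp J K hJK V ∧ U' ∈ histGood F ℰp (θBal F.L γ b₀ p₀) K J ∧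
            wilsonAction4 U' = minActionRegPr F J K hJK ε₀ V},
        ∀ U ∈ fibre F ℰp J K hJK V, U ∈ histGood F ℰp (θBal F.L γ b₀ p₀) K J →
          μ * ((F.L : ℝ)⁻¹) ^ (2 * (K - J)) *
              (⨅ w : {w : GaugeTransf (F.P K) 0 (Matrix.specialUnitaryGroup (Fin 2) ℂ) | ∀ U : GaugeField (F.P K) 0 (Matrix.specialUnitaryGroup (Fin 2) ℂ),
                  descendTo F ℰp J K hJK (GaugeField.gaugeAct w U) = descendTo F ℰp J K hJK U}, ∑ ℓ : PBond (F.P K) 0,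
                dist1 (U ℓ * ((GaugeField.gaugeAct (w : GaugeTransf (F.P K) 0 (Matrix.specialUnitaryGroup (Fin 2) ℂ)) U₀) ℓ)⁻¹) ^ 2)
            ≤ wilsonAction4 U - minActionRegPr F J K hJK ε₀ V) :
    ∀ (L : ℕ), ∃ c₀ : ℝ, 0 < c₀ ∧ c₀ ≤ 1 ∧ ∀ (cw : ℝ), 0 < cw → cw ≤ c₀ → ∃ pS : ℝ, ∀ (b₀ p₀ : ℝ), 0 < b₀ → pS ≤ p₀ → 0 < p₀ → ∃ ε₁ : ℝ, 0 < ε₁ ∧ ∀ (ε₀ : ℝ), 0 < ε₀ → ε₀ ≤ ε₁ →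
    ∃ γ₁ : ℝ, 0 < γ₁ ∧ ∃ μ : ℝ, 0 < μ ∧ ∀ (F : T3Family) (γ : ℝ), F.L = L → 0 < γ → γ ≤ γ₁ →
      ∀ (J K : ℕ) (hJK : J ≤ K), K - J = m → ∀ (V : GaugeField (F.P J) 0 (Matrix.specialUnitaryGroup (Fin 2) ℂ)), PlaqSmall (θBal F.L γ (cw * b₀) p₀ J) V →
        ∀ U₀ ∈ {U' : GaugeField (F.P K) 0 (Matrix.specialUnitaryGroup (Fin 2) ℂ) | U' ∈ fibre F ℰp J K hJK V ∧ U' ∈ histGood F ℰp (θBal F.L γ b₀ p₀) K J ∧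
            wilsonAction4 U' = minActionRegPr F J K hJK ε₀ V},
        ∀ U ∈ fibre F ℰp J K hJK V, U ∈ histGood F ℰp (θBal F.L γ b₀ p₀) K J →
          μ * ((F.L : ℝ)⁻¹) ^ (2 * (K - J)) *
              (⨅ w : {w : GaugeTransf (F.P K) 0 (Matrix.specialUnitaryGroup (Fin 2) ℂ) | ∀ U : GaugeField (F.P K) 0 (Matrix.specialUnitaryGroup (Fin 2) ℂ),
                  descendTo F ℰp J K hJK (GaugeField.gaugeAct w U) = descendTo F ℰp J K hJK U}, ∑ ℓ : PBond (F.P K) 0,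
                dist1 (U ℓ * ((GaugeField.gaugeAct (w : GaugeTransf (F.P K) 0 (Matrix.specialUnitaryGroup (Fin 2) ℂ)) U₀) ℓ)⁻¹) ^ 2)
            ≤ wilsonAction4 U - minActionRegPr F J K hJK ε₀ V := by
  intro L
  obtain ⟨c₁, hc₁, hc₁1, H1⟩ := hIrr L
  obtain ⟨c₂, hc₂, -, H2⟩ := hA L
  refine ⟨min c₁ c₂, lt_min hc₁ hc₂, (min_le_left _ _).trans hc₁1, ?_⟩
  intro cw hcw hcwle
  obtain ⟨pS₁, H1⟩ := H1 cw hcw (hcwle.trans (min_le_left _ _))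
  obtain ⟨pS₂, H2⟩ := H2 cw hcw (hcwle.trans (min_le_right _ _))
  refine ⟨max pS₁ pS₂, ?_⟩
  intro b₀ p₀ hb hpS hp
  obtain ⟨e₁, he₁, H1⟩ := H1 b₀ p₀ hb ((le_max_left _ _).trans hpS) hp
  obtain ⟨e₂, he₂, H2⟩ := H2 b₀ p₀ hb ((le_max_right _ _).trans hpS) hp
  obtain ⟨γf, hγf, H3⟩ := gapOrbit_caseB_allDepths_volumeUniform L b₀ p₀ hb hp
  obtain ⟨μf, hμf, H3⟩ := H3 m
  refine ⟨min e₁ e₂, lt_min he₁ he₂, ?_⟩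
  intro ε₀ hε₀ hε₀le
  obtain ⟨γa, hγa, μa, hμa, H1⟩ := H1 ε₀ hε₀ (hε₀le.trans (min_le_left _ _))
  obtain ⟨γb, hγb, μb, hμb, H2⟩ := H2 ε₀ hε₀ (hε₀le.trans (min_le_right _ _))
  obtain ⟨γc, hγc, hγc1, hθ⟩ := exists_gamma_forall_θBal_le (b₀ := cw * b₀) (p₀ := p₀) (mul_pos hcw hb) hp (σ := 2) two_pos
  refine ⟨min γa (min γb (min γf γc)), lt_min hγa (lt_min hγb (lt_min hγf hγc)), min μa (min μb μf), lt_min hμa (lt_min hμb hμf), ?_⟩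
  intro F γ hFL hγ hγle J K hJK hm V hV U₀ hU₀ U hU hUg
  have hp0 : (0 : ℝ) ≤ ((F.L : ℝ)⁻¹) ^ (2 * (K - J)) := pow_nonneg (inv_nonneg.mpr (Nat.cast_nonneg _)) _
  have hI0 : (0 : ℝ) ≤ (⨅ w : {w : GaugeTransf (F.P K) 0 (Matrix.specialUnitaryGroup (Fin 2) ℂ) | ∀ U : GaugeField (F.P K) 0 (Matrix.specialUnitaryGroup (Fin 2) ℂ),
                  descendTo F ℰp J K hJK (GaugeField.gaugeAct w U) = descendTo F ℰp J K hJK U}, ∑ ℓ : PBond (F.P K) 0,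
                dist1 (U ℓ * ((GaugeField.gaugeAct (w : GaugeTransf (F.P K) 0 (Matrix.specialUnitaryGroup (Fin 2) ℂ)) U₀) ℓ)⁻¹) ^ 2) :=
    Real.iInf_nonneg fun w => Finset.sum_nonneg fun _ _ => sq_nonneg _
  rcases irr_or_caseA_or_loopHol_central V with hirr | hcA | ⟨x₀, hcen⟩
  · exact gapBody_mono_mu (min_le_left _ _) hp0 hI0
      (H1 F γ hFL hγ (hγle.trans (min_le_left _ _)) J K hJK hm V hV hirr U₀ hU₀ U hU hUg)
  · exact gapBody_mono_mu ((min_le_right _ _).trans (min_le_left _ _)) hp0 hI0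
      (H2 F γ hFL hγ (hγle.trans ((min_le_right _ _).trans (min_le_left _ _))) J K hJK hm V hV hcA U₀ hU₀ U hU hUg)
  · have hγc' : γ ≤ γc := hγle.trans ((min_le_right _ _).trans ((min_le_right _ _).trans (min_le_right _ _)))
    have hL : 1 ≤ F.L := F.hL.2.le
    have h2 : θBal F.L γ (cw * b₀) p₀ J ≤ 2 := hθ F.L hL γ hγ hγc' J
    exact gapBody_mono_mu ((min_le_right _ _).trans (min_le_right _ _)) hp0 hI0
      (H3 F γ hFL hγ (hγle.trans ((min_le_right _ _).trans ((min_le_right _ _).trans (min_le_left _ _)))) J K hJK hm ε₀ hε₀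
        V x₀ hcen _ h2 hV U₀ hU₀ U hU hUg)

end Summit.QuantumFields.YangMills.Theorems.FluctuationComparisonRegPrIntLS2BetaGapOrbitCaseBVolumeUniform

end
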